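import Literature.AlgebraicGeometry.Resolution.FormalNormalCrossingsLemmas
import Mathlib.RingTheory.AdicCompletion.LocalRing
import HarnessLib

/-!
# The formal-to-étale bridge, formal side: the coordinate equations have a formal solution

Topic: `Literature/AlgebraicGeometry/Resolution`. Companion to `FormalNormalCrossingsAlgebra.lean`
(de Jong 1996, 4.25 (i)/4.28 via Artin approximation). Let `A` be a Noetherian local ring with
completion `Â`, `γ : R → A` a ring map (the germ map of an affine chart), `g₁, …, g_m ∈ R`
(generators of the ideal of the divisor), `t₁, …, t_n ∈ R` with `(γ t₁, …, γ t_n) = 𝔪_A`, and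
`e : Â ≅ k⟦X₁, …, X_d⟧` an isomorphism carrying the completed ideal `(g) Â` to `(X₁ ⋯ X_r)`
(the formal normal crossings condition of de Jong 1996, 4.25 (i), as rendered in
`DeJong1996.NormalFormPair`). Then the system

  (E1) `g_j = a_j · ∏_{i < r} y_i`,  (E2) `∏_{i < r} y_i = ∑_j b_j g_j`,
  (E3) `t_l = ∑_i c_{li} y_i`,      (E4) `y_i = ∑_l d_{il} t_l`

has the solution `ybᵢ = e⁻¹(Xᵢ)` in `Â` (`exists_formal_solution`), since `e⁻¹` carries
`(X₁ ⋯ X_r)` to `(g) Â` and the maximal ideal `(X₁, …, X_d)` of `k⟦X⟧`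
(`maximalIdeal_mvPowerSeries_eq_span_range_X`) to `𝔪_Â = 𝔪_A Â = (γ t) Â`.

## Sources

* A. J. de Jong, *Smoothness, semi-stability and alterations*, Publ. Math. IHÉS 83 (1996),
  4.25 (i).
* M. Artin, *Algebraic approximation of structures over complete local rings*, Publ. Math.
  IHÉS 36 (1969), Cor. 2.1.
-/

noncomputable section

open IsLocalRing

universe u

namespace Literature.AlgebraicGeometry.Resolution

/-- **The formal solution of (E1)–(E4)** (see the module docstring). [folklore] -/
theorem exists_formal_solution {R A : Type u} [CommRing R] [CommRing A] [IsLocalRing A]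
    [IsNoetherianRing A] {k : Type u} [Field k] (γ : R →+* A) {d r m n : ℕ} (gI : Fin m → R)
    (t : Fin n → R) (ht : (Ideal.span (Set.range t)).map γ = maximalIdeal A)
    (e : AdicCompletion (maximalIdeal A) A ≃+* MvPowerSeries (Fin d) k)
    (he : (((Ideal.span (Set.range gI)).map γ).map
        (algebraMap A (AdicCompletion (maximalIdeal A) A))).map e.toRingHom =
      Ideal.span {∏ i ∈ Finset.univ.filter (fun i : Fin d => (i : ℕ) < r), MvPowerSeries.X i}) :
    ∃ (yb : Fin d → AdicCompletion (maximalIdeal A) A)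
      (ab bb : Fin m → AdicCompletion (maximalIdeal A) A)
      (cb : Fin n → Fin d → AdicCompletion (maximalIdeal A) A)
      (db : Fin d → Fin n → AdicCompletion (maximalIdeal A) A),
      (∀ j, (algebraMap A _ (γ (gI j))) =
        ab j * ∏ i ∈ Finset.univ.filter (fun i : Fin d => (i : ℕ) < r), yb i) ∧
      (∏ i ∈ Finset.univ.filter (fun i : Fin d => (i : ℕ) < r), yb i =
        ∑ j, bb j * algebraMap A _ (γ (gI j))) ∧
      (∀ l, algebraMap A _ (γ (t l)) = ∑ i, cb l i * yb i) ∧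
      (∀ i, yb i = ∑ l, db i l * algebraMap A _ (γ (t l))) := by
  classical
  set Â := AdicCompletion (maximalIdeal A) A
  set ι : R →+* Â := (algebraMap A Â).comp γ with hι
  set nce : MvPowerSeries (Fin d) k :=
    ∏ i ∈ Finset.univ.filter (fun i : Fin d => (i : ℕ) < r), MvPowerSeries.X i with hnce
  let yb : Fin d → Â := fun i => e.symm (MvPowerSeries.X i)
  have hprod : ∏ i ∈ Finset.univ.filter (fun i : Fin d => (i : ℕ) < r), yb i = e.symm nce := by
    simp only [yb, hnce, map_prod]
  -- the completed ideal and its image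
  have hI : ((Ideal.span (Set.range gI)).map γ).map (algebraMap A Â) =
      Ideal.span (Set.range (ι ∘ gI)) := by
    rw [Ideal.map_map, Ideal.map_span, ← Set.range_comp]
  have heI : (Ideal.span (Set.range (ι ∘ gI))).map (e : Â →+* _) = Ideal.span {nce} := by
    rw [← hI]
    exact he
  -- the maximal ideal of the completion: `𝔪_Â = (yb) = (ι t)`
  have hmax₁ : maximalIdeal Â = Ideal.span (Set.range yb) := by
    have h1 : (maximalIdeal (MvPowerSeries (Fin d) k)).map (e.symm : _ →+* Â) = maximalIdeal Â :=
      IsLocalRing.eq_maximalIdeal (Ideal.map_isMaximal_of_equiv e.symm (p := maximalIdeal _))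
    rw [← h1, maximalIdeal_mvPowerSeries_eq_span_range_X, Ideal.map_span, ← Set.range_comp]
    rfl
  have hmax₂ : maximalIdeal Â = Ideal.span (Set.range (ι ∘ t)) := by
    rw [AdicCompletion.maximalIdeal_eq_map,
      show (maximalIdeal A).map (algebraMap A Â) =
        ((Ideal.span (Set.range t)).map γ).map (algebraMap A Â) by rw [ht],
      Ideal.map_map, Ideal.map_span, ← Set.range_comp]
  -- (E1)
  have h1 : ∀ j, ∃ ab : Â, ι (gI j) =
      ab * ∏ i ∈ Finset.univ.filter (fun i : Fin d => (i : ℕ) < r), yb i := by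
    intro j
    have hmem : e (ι (gI j)) ∈ Ideal.span {nce} := by
      rw [← heI]
      exact Ideal.mem_map_of_mem _ (Ideal.subset_span ⟨j, rfl⟩)
    obtain ⟨cj, hcj⟩ := Ideal.mem_span_singleton'.mp hmem
    refine ⟨e.symm cj, ?_⟩
    rw [hprod, ← map_mul, hcj, RingEquiv.symm_apply_apply]
  choose ab hab using h1
  -- (E2)
  have h2 : e.symm nce ∈ Ideal.span (Set.range (ι ∘ gI)) := by
    have : nce ∈ (Ideal.span (Set.range (ι ∘ gI))).map (e : Â →+* _) := by
      rw [heI]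
      exact Ideal.mem_span_singleton_self _
    rwa [Ideal.map_comap_of_equiv, Ideal.mem_comap] at this
  obtain ⟨bb, hbb⟩ := Ideal.mem_span_range_iff_exists_fun.mp h2
  -- (E3)
  have h3 : ∀ l, ∃ cb : Fin d → Â, ∑ i, cb i * yb i = ι (t l) := by
    intro l
    apply Ideal.mem_span_range_iff_exists_fun.mp
    rw [← hmax₁, hmax₂]
    exact Ideal.subset_span ⟨l, rfl⟩
  choose cb hcb using h3
  -- (E4)
  have h4 : ∀ i, ∃ db : Fin n → Â, ∑ l, db l * (ι ∘ t) l = yb i := by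
    intro i
    apply Ideal.mem_span_range_iff_exists_fun.mp
    rw [← hmax₂, hmax₁]
    exact Ideal.subset_span ⟨i, rfl⟩
  choose db hdb using h4
  refine ⟨yb, ab, bb, cb, db, fun j => hab j, ?_, fun l => (hcb l).symm, fun i => (hdb i).symm⟩
  rw [hprod, ← hbb]
  rfl

end Literature.AlgebraicGeometry.Resolution

end
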